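import Summits.NavierStokesRegularity.NavierStokesRegularity.Theses.TautLoopKelvin
import Summits.NavierStokesRegularity.NavierStokesRegularity.Theses.CirculationRelay
import Summits.NavierStokesRegularity.NavierStokesRegularity.Theorems.TautLoopKelvinCirculationFloorBallFlux
import Summits.NavierStokesRegularity.NavierStokesRegularity.Theorems.TautLoopKelvinCirculationFloorCoreUnitScale
import Summits.NavierStokesRegularity.NavierStokesRegularity.Theorems.TautLoopKelvinCirculationFloorBlockScaling
import Summits.NavierStokesRegularity.NavierStokesRegularity.Theorems.TautLoopKelvinCirculationFloorDyadicBridge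
import Summits.NavierStokesRegularity.NavierStokesRegularity.Theorems.TautLoopKelvinCirculationFloorExtension
import Literature.Analysis.FluidPDE.TaoLocalisationHolds
import Literature.Analysis.FluidPDE.LerayLocalRegularH1Proofs
import HarnessLib

/-!
# `TautLoopKelvin.CirculationFloor` (= `CirculationRelay.CirculationFloor`): the Kelvin-battery floor, PROVED

Crux item `stmt-NavierStokesRegularity-1538` (rank 4 of `route-NavierStokesRegularity-TautLoopKelvin`, rank 9 of
`route-NavierStokesRegularity-CirculationRelay`; the two route copies are the same proposition by `rfl`). Line
`birth` (registered skeleton `Cruxes/CirculationFloor/Lines/birth.lean`, reshaped by the lead into 7 stubs, all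
landed under `Theorems/TautLoopKelvinCirculationFloor*.lean`). This file is the sorry-free skeleton: the glue
`sliceRegularity` (Tao 2013 on closed sub-slabs), `dyadicSmall_of_ballFlux` (the circulation → Besov conversion,
from `stub_coreUnitScale` + `stub_blockScaling` + `stub_dyadicBridge`) and the contrapositive composition
`circulationFloor_proof` with `stub_ballFlux_of_smallCircles` and `stub_extension_of_dyadicSmall`.

THE THEOREM. There is an absolute `c₀ > 0` such that for every `ν, T > 0` and every classical solution `(u, p)` of
unforced Navier–Stokes on `ℝ³ × [0,T)` which is Leray–Hopf on `[0,T)` from the rapidly decaying datum `u 0` and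
has NO smooth extension past `T`, and every `δ > 0`, some slice `t ∈ [0,T)` carries a planar circle (centre `c`,
orthonormal frame `e₁ e₂`, radius `0 < r ≤ δ`) with circulation `|∮ u(t)·dl| ≥ c₀ ν`.

PROOF (contrapositive: small circulations on all small circles ⇒ smooth extension past `T`).
1. `stub_ballFlux_of_smallCircles`: circles ⇒ normal vorticity fluxes `|∫_{B_ρ(x)} ⟪curl u(t), n⟫| ≤ 2ρε`
   (slicing + Stokes on discs).
2. `sliceRegularity`: every slice is smooth, divergence free, with bounded derivatives of all orders (Tao 2013,
   `tao2011_hasBoundedSobolevNormsOn_holds`, the only use of the rapid decay of the datum).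
3. `stub_coreUnitScale` (the circulation Bernstein inequality `‖Δ̇₀v‖_∞ ≤ C ε`, physical space: `K₀ = -Σ∂ₖ∂ₖL`,
   `∂ₖL = Mₖ ⋆ 𝟙_{B(0,θ)}` by symbol division through `𝓕𝟙_B`, `Δv = -curl curl v`) transported to every dyadic
   scale by `stub_blockScaling` and converted to Cheskidov–Shvydkoy's quantity by `stub_dyadicBridge`:
   `limsup_j sup_t 2^{-j}‖Δ̇_j U(t)‖_∞ ≤ K ε`.
4. `stub_extension_of_dyadicSmall`: Cheskidov–Shvydkoy 2010 Lemma 3.2 (`cheskidov_shvydkoy_dyadic_regular_holds`,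
   PROVED in tree) + Leray continuation through `t = T`.
With `c₀ := c/(2K)` the smallness `K c₀ ν = cν/2 < cν` holds and the extension contradicts the hypothesis.

## References

* A. Cheskidov, R. Shvydkoy, Arch. Ration. Mech. Anal. 195 (2010) = arXiv:0708.3067, Lemma 3.2. [CheskidovShvydkoy2010]
* H. Bahouri, J.-Y. Chemin, R. Danchin, *Fourier Analysis and Nonlinear PDE* (2011), Lemma 2.1–2.2. [BahouriCheminDanchin2011]
* T. Tao, Anal. PDE 6 (2013) = arXiv:1108.1165, Cor. 11.1, Thm. 5.4. [Tao2011]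
-/

noncomputable section

open Set MeasureTheory Filter Topology
open scoped SchwartzMap ENNReal

-- the summit and its single sub-problem share the name (CONVENTIONS §1), as in every Theorems file
set_option linter.dupNamespace false

namespace Summit.NavierStokesRegularity.NavierStokesRegularity.Theorems

open Literature.Analysis Literature.Analysis.FluidPDE Literature.Analysis.FunctionSpaces
open Summit.NavierStokesRegularity.NavierStokesRegularity.Theorems.CirculationFloor.Birth

/-- **Per-slice regularity** (glue of PROVED tree facts). Every slice `u t`, `t ∈ [0,T)`, of a classical
Leray–Hopf solution from a rapidly decaying datum is smooth, divergence free, and has bounded derivatives of all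
orders: Tao 2013 (Cor. 11.1 + Thm. 5.4, tree `tao2011_hasBoundedSobolevNormsOn_holds`) on the closed slab
`[0, (t+T)/2]`, energy from the Leray–Hopf inequality, then the Sobolev imbedding
`exists_forall_norm_iteratedFDeriv_le_of_hasBoundedSobolevNormsOn`. [folklore] -/
theorem circulationFloor_sliceRegularity {ν T : ℝ} (hν : 0 < ν)
    {u : ℝ → EuclideanSpace ℝ (Fin 3) → EuclideanSpace ℝ (Fin 3)} {p : ℝ → EuclideanSpace ℝ (Fin 3) → ℝ}
    (hcl : IsClassicalNSSolutionOn (Set.Ico 0 T) ν 0 u p) (hLH : IsLerayHopfOn T ν 0 (u 0) u)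
    (hdec : HasRapidSpatialDecay (u 0)) {t : ℝ} (ht : t ∈ Set.Ico 0 T) :
    ContDiff ℝ (⊤ : ℕ∞) (u t) ∧ (∀ n : ℕ, ∃ B : ℝ, ∀ x, ‖iteratedFDeriv ℝ n (u t) x‖ ≤ B) ∧
      VectorCalculus.IsDivFree (u t) := by
  have hsmooth : ContDiff ℝ (⊤ : ℕ∞) (u t) := hcl.contDiff_velocity ht
  refine ⟨hsmooth, ?_, hcl.divFree t ht⟩
  -- Tao 2013 on the closed slab `[0, T₁]`, `T₁ = (t + T)/2`
  set T₁ : ℝ := (t + T) / 2 with hT₁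
  have hT₁pos : 0 < T₁ := by rw [hT₁]; linarith [ht.1, ht.2]
  have hT₁T : T₁ < T := by rw [hT₁]; linarith [ht.2]
  have htT₁ : t ∈ Icc 0 T₁ := ⟨ht.1, by rw [hT₁]; linarith [ht.2]⟩
  have hsol' : IsClassicalNSSolutionOn (Icc 0 T₁) ν 0 u p :=
    hcl.mono (Icc_subset_Ico_right hT₁T) (uniqueDiffOn_Icc hT₁pos)
  have hEn' : ∃ C : NNReal, ∀ s ∈ Icc 0 T₁, ∫⁻ x, ‖u s x‖ₑ ^ 2 ≤ C :=
    ⟨(2 * VectorCalculus.kineticEnergy (u 0)).toNNReal, fun s hs =>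
      hLH.lintegral_enorm_sq_le hν.le ⟨hs.1, hs.2.trans hT₁T.le⟩⟩
  have hB : HasBoundedSobolevNormsOn (Icc 0 T₁) u :=
    tao2011_hasBoundedSobolevNormsOn_holds hν hT₁pos hsol' hEn' hdec
  intro n
  obtain ⟨C, hC⟩ := exists_forall_norm_iteratedFDeriv_le_of_hasBoundedSobolevNormsOn
    (fun s hs => hsol'.contDiff_velocity hs) hB n
  exact ⟨C, fun x => hC t htT₁ x⟩

/-- **The circulation → Besov conversion** (birth stub 2, PROVED from `stub_coreUnitScale`,
`stub_blockScaling`, `stub_dyadicBridge` and `circulationFloor_sliceRegularity`). There is an ABSOLUTE `K > 0`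
such that for every classical Leray–Hopf solution `(u,p)` on `ℝ³ × [0,T)` from a rapidly decaying datum and all
`δ, ε > 0`: if along every slice `t ∈ [0,T)` every ball of radius `0 < ρ ≤ δ` carries normal vorticity flux
`≤ 2ρε`, then the slices have tempered distributions `U t` with
`limsup_{j→∞} sup_{t∈(0,T)} 2^{-j} ‖Δ̇_j U(t)‖_∞ ≤ K ε`. [folklore] -/
theorem circulationFloor_dyadicSmall_of_ballFlux :
    ∃ K : ℝ, 0 < K ∧ ∀ (ν T : ℝ), 0 < ν → 0 < T →
      ∀ (u : ℝ → EuclideanSpace ℝ (Fin 3) → EuclideanSpace ℝ (Fin 3)) (p : ℝ → EuclideanSpace ℝ (Fin 3) → ℝ),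
        Literature.Analysis.FluidPDE.IsClassicalNSSolutionOn (Set.Ico 0 T) ν 0 u p →
        Literature.Analysis.FluidPDE.IsLerayHopfOn T ν 0 (u 0) u →
        Literature.Analysis.FluidPDE.HasRapidSpatialDecay (u 0) →
        ∀ (δ ε : ℝ), 0 < δ → 0 < ε →
          (∀ t ∈ Set.Ico 0 T, ∀ (x n : EuclideanSpace ℝ (Fin 3)) (ρ : ℝ), ‖n‖ = 1 → 0 < ρ → ρ ≤ δ →
              |∫ y in Metric.ball x ρ, inner ℝ (Literature.Analysis.FluidPDE.curl (u t) y) n| ≤ 2 * ρ * ε) →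
          ∃ U : ℝ → TemperedDistribution (EuclideanSpace ℝ (Fin 3)) (EuclideanSpace ℂ (Fin 3)),
            (∀ t ∈ Set.Icc 0 T, Literature.Analysis.FluidPDE.IsDistributionOf (u t) (U t)) ∧
            Filter.limsup (fun j : ℕ => ⨆ t ∈ Set.Ioo 0 T,
                Literature.Analysis.FunctionSpaces.lpBlockWeight (-1) ⊤ (U t) (j : ℤ)) Filter.atTop ≤
              ENNReal.ofReal (K * ε) := by
  obtain ⟨C, θ, hC, hθ, hθ1, hcore⟩ := stub_coreUnitScale
  have hscaled := stub_blockScaling C θ hC hθ hθ1 hcore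
  refine ⟨C, hC, ?_⟩
  intro ν T hν hT u p hcl hLH hdec δ ε hδ hε hball
  -- a dyadic scale below `δ`: `θ 2^{-J} ≤ δ`
  obtain ⟨J, hJ⟩ : ∃ J : ℕ, θ * (2 : ℝ) ^ (-(J : ℤ)) ≤ δ := by
    obtain ⟨J, hJ⟩ := exists_pow_lt_of_lt_one (div_pos hδ hθ) (by norm_num : (1 / 2 : ℝ) < 1)
    refine ⟨J, ?_⟩
    rw [zpow_neg, zpow_natCast, ← inv_pow, show ((2 : ℝ)⁻¹) = 1 / 2 by norm_num]
    have := (lt_div_iff₀ hθ).1 hJ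
    linarith [mul_comm ((1 / 2 : ℝ) ^ J) θ]
  -- the pointwise block bounds on every slice, at every scale `j ≥ J`
  have hblock : ∀ t ∈ Set.Ico 0 T, ∀ j : ℕ, J ≤ j → ∀ x : EuclideanSpace ℝ (Fin 3),
      ‖blockFn (j : ℤ) (u t) x‖ ≤ C * (2 : ℝ) ^ j * ε := by
    intro t ht j hj x
    obtain ⟨hsm, hbd, hdiv⟩ := circulationFloor_sliceRegularity hν hcl hLH hdec ht
    refine hscaled (u t) hsm hbd hdiv j ε hε.le ?_ x
    intro y m
    have hr : 0 < θ * (2 : ℝ) ^ (-(j : ℤ)) := mul_pos hθ (zpow_pos two_pos _)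
    have hrδ : θ * (2 : ℝ) ^ (-(j : ℤ)) ≤ δ := by
      refine le_trans (mul_le_mul_of_nonneg_left ?_ hθ.le) hJ
      exact zpow_le_zpow_right₀ (by norm_num) (by omega)
    exact hball t ht y (EuclideanSpace.single m (1 : ℝ)) _ (by simp) hr hrδ
  exact stub_dyadicBridge ν T hT u hLH C ε J hC.le hε.le hblock

/-- **`TautLoopKelvin.CirculationFloor` — the Kelvin-battery floor in loop language, PROVED** (crux item
`stmt-NavierStokesRegularity-1538`): the crux BY NAME from the landed stubs. `c₀ := c/(2K)` with `K` from
`circulationFloor_dyadicSmall_of_ballFlux` and `c` from `stub_extension_of_dyadicSmall`; contrapositive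
(`by_contra` + `push Not`): if no circle of radius `≤ δ` at any `t < T` carries `c₀ν`, `stub_ballFlux_of_smallCircles`
(slices are `C¹`) bounds every small-ball vorticity flux by `2ρ c₀ν`, the conversion makes the dyadic limsup
`≤ ofReal (K c₀ ν) = ofReal (cν/2) < ofReal (cν)`, and the Cheskidov–Shvydkoy continuation extends the solution
past `T`, contradicting `¬ HasSmoothExtensionPast`. [cite: CheskidovShvydkoy2010, Lemma 3.2] -/
theorem circulationFloor_proof : Theses.TautLoopKelvin.CirculationFloor := by
  obtain ⟨K, hK, hS2⟩ := circulationFloor_dyadicSmall_of_ballFlux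
  obtain ⟨c, hc, hS3⟩ := stub_extension_of_dyadicSmall
  refine ⟨c / (2 * K), by positivity, ?_⟩
  intro ν T hν hT u p hcl hLH hdec hext δ hδ
  by_contra H
  push Not at H
  have hε : 0 < c / (2 * K) * ν := by positivity
  have hball : ∀ t ∈ Set.Ico 0 T, ∀ (x n : EuclideanSpace ℝ (Fin 3)) (ρ : ℝ), ‖n‖ = 1 → 0 < ρ → ρ ≤ δ →
      |∫ y in Metric.ball x ρ, inner ℝ (Literature.Analysis.FluidPDE.curl (u t) y) n| ≤
        2 * ρ * (c / (2 * K) * ν) := by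
    intro t ht x n ρ hn hρ hρδ
    have h1 : ContDiff ℝ 1 (u t) := (hcl.contDiff_velocity ht).of_le (by exact_mod_cast le_top)
    refine stub_ballFlux_of_smallCircles (u t) h1 δ _ hδ hε.le ?_ x n ρ hn hρ hρδ
    intro c' e₁ e₂ r hr hrδ he₁ he₂ he12
    exact (H t ht c' e₁ e₂ r hr hrδ he₁ he₂ he12).le
  obtain ⟨U, hU, hsmall⟩ := hS2 ν T hν hT u p hcl hLH hdec δ _ hδ hε hball
  have hlt : Filter.limsup (fun j : ℕ => ⨆ t ∈ Set.Ioo 0 T,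
      Literature.Analysis.FunctionSpaces.lpBlockWeight (-1) ⊤ (U t) (j : ℤ)) Filter.atTop <
        ENNReal.ofReal (c * ν) := by
    refine lt_of_le_of_lt hsmall ?_
    rw [ENNReal.ofReal_lt_ofReal_iff (mul_pos hc hν)]
    have hKc : K * (c / (2 * K) * ν) = c * ν / 2 := by
      field_simp
    rw [hKc]
    linarith [mul_pos hc hν]
  exact hext (hS3 ν T hν hT u p hcl hLH hdec U hU hlt)

/-- **`CirculationRelay.CirculationFloor`, PROVED** — the shared item's copy in the route
`route-NavierStokesRegularity-CirculationRelay` (rank 9) is the same proposition (`rfl`). [cite: CheskidovShvydkoy2010, Lemma 3.2] -/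
theorem circulationRelay_circulationFloor_proof : Theses.CirculationRelay.CirculationFloor :=
  circulationFloor_proof

end Summit.NavierStokesRegularity.NavierStokesRegularity.Theorems

end
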